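import Summits.AtomisticToContinuum.Crystallization.Theorems.ExcessDecayLiouvilleInductionStepB
import Summits.AtomisticToContinuum.Crystallization.Theorems.ExcessDecayLiouvilleStepDecay

/-!
# Route `ExcessDecayLiouville`: the induction step at one centre and one scale (nonlinear half, XXVIII)

Harmonic-replacement architecture for item `ExcessDecay` (stmt-AtomisticToContinuum-9334), nonlinear half.
`induction_step` glues `step_correction` (part A), `step_h_currencies` (part B) and `step_decay`: from a
RELAXED approximant `aff` at scale `ρ` with the cubic envelope `C`, the sharp mass `M_sh` at the mass radius,
the crude bound `D_v` and the global gradient bound `NN_tot` of the step field `v = χ·ũ`, and numerical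
parameters `E_w, W, Θ₁, Θ₂, V, J` dominating the explicit currency formulas (hypotheses `hEw … hJ`, checked by
the caller from the constants of the iteration) in the relaxation regime (`hs₁, hs₂, hs₃`), it produces the
Taylor data, the relaxation shift and the new relaxed approximant `aff + T + 𝟙_{S₀}ξ`, with the QUARTIC
POINTWISE ENVELOPE of the new step field on `B_ρ(c₀)`:
`‖χ·((π x − x) − aff' x)‖² ≤ 3 (1428 √Θ₂ (dist(x,c₀) + 11/10)²)² + 3 W + 3 ‖ξ‖²`.
All `[folklore]`; helper lemmas, nothing here closes an item.
-/

noncomputable section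

namespace Summit.AtomisticToContinuum.Crystallization.Theorems.ExcessDecayLiouville

open scoped BigOperators Topology InnerProductSpace RealInnerProductSpace Classical
open Literature.MathematicalPhysics.StatisticalMechanics
open Summit.AtomisticToContinuum.Crystallization.Theorems.PhononStabilityNegative

local notation "E3" => EuclideanSpace ℝ (Fin 3)

-- Local notation: the force-constant map `K(e)w = h(|e|²)w + 2⟪e,w⟫h′(|e|²)e`.
local notation3 "𝕂[" e "] " w:max =>
  (-((‖e‖ ^ 2)⁻¹) ^ 7 + ((‖e‖ ^ 2)⁻¹) ^ 4) • w + (2 * ⟪e, w⟫ * (7 * ((‖e‖ ^ 2)⁻¹) ^ 8 - 4 * ((‖e‖ ^ 2)⁻¹) ^ 5)) • e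
-- Local notation: the pair force `F(x) = h(|x|²) x`.
local notation3 "𝐅[" x "]" => ((-((‖x‖ ^ 2)⁻¹) ^ 7 + ((‖x‖ ^ 2)⁻¹) ^ 4) • x)
set_option quotPrecheck false in
-- Local notation: ball indicator.
local notation "𝟙ᵇ[" x ", " c ", " R "]" => (if dist (x : EuclideanSpace ℝ (Fin 3)) c ≤ R then (1 : ℝ) else 0)
-- the constants of one level in mass form
local notation "Cₐ" => (19 * (1024 / ((23 / 25 : ℝ) ^ 3 * (23 / 25 : ℝ) ^ 3)) + 38 * (1024 / (23 / 25 : ℝ) ^ 3))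
local notation "Cⱼ" => (9961472 : ℝ)
-- the two Lipschitz constants of the natural force
local notation "Cˢ" => (38 * (25 / 23) * (1024 / ((23 / 25 : ℝ) ^ 3 * (23 / 25 : ℝ) ^ 4)) +
  (1024 / ((23 / 25 : ℝ) ^ 3 * (23 / 25 : ℝ) ^ 4)) * ((25 / 23 : ℝ) ^ 2 * (72 + 2000)))
local notation "Cᴮ" => (5660 * (1024 / ((23 / 25 : ℝ) ^ 3 * (23 / 25 : ℝ) ^ 3)))
-- the gradient currency as a quintic: coefficients (as in `StepEnergyBound`)
local notation "𝔮₁[" κ ", " Λ' ", " C "]" => ((64 * (2 / κ) * (131072 * (38 * 4 ^ 5 * (1024 / (23 / 25 : ℝ) ^ 3)) +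
          Λ' * 3200000 * (1024 / (23 / 25 : ℝ) ^ 3) * 72704) * C + 64 * 120 ^ 5 * 327680 * C +
        4 / κ * (Λ' * 32768 * 256 * C + 1245184 * 4096 * C)))
local notation "𝔮₂[" κ ", " Λ' ", " Dv ", " r "]" => ((4 / κ * (Λ' * 32768 * 8192 * (7 * r / 8) ^ 3 * Dv ^ 2 / ((r / 4) ^ 7 * 4) +
        1245184 * 8192 * (7 * r / 8) ^ 3 * Dv ^ 2 / (r / 4) ^ 7)))
local notation "𝔮₃[" κ ", " Λ' ", " D₀ ", " r "]" => ((4 / κ * (Λ' * 32768 * (32 * r ^ 3 * ((3 * r / 8)⁻¹ ^ 8 * (D₀ / 2) ^ 2)))))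
local notation "𝔮₄[" κ ", " C "]" => ((2 ^ (5 + 1) * (2 / κ * (19 * 16 * (1024 / ((23 / 25 : ℝ) ^ 3 * (23 / 25 : ℝ) ^ 3))) +
        16 * (11 / 10 : ℝ) ^ 8 * (1024 / ((23 / 25 : ℝ) ^ 3 * (23 / 25 : ℝ) ^ 3))) * (32 * 4 ^ 6) * C))
local notation "𝔮₅[" κ ", " C ", " Φ₀ "]" => ((4 / κ * (16 * Real.sqrt (2048 * C) * Φ₀)))
set_option quotPrecheck false in
-- the forcing constant on `B_{r/4}(c)`
local notation "𝚽[" Du ", " r ", " δ "]" => (31488 * (1024 / ((23 / 25 : ℝ) ^ 3 * (r / 2) ^ 4)) + 2048 / (δ ^ 3 * (r / 4) ^ 4) +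
        (38 * Du * (1024 / ((23 / 25 : ℝ) ^ 3 * (r / 4) ^ 5)) + 38 * Du * (1024 / ((23 / 25 : ℝ) ^ 3 * (r / 2) ^ 5))))

section

variable {X : Set E3} {c : E3} {r ε δ κ : ℝ} {t : Fin 2 → E3} {A : E3 →L[ℝ] E3} {π : E3 → E3}
  {aff : E3 → E3} {a : Fin 2 → E3} {B : E3 →L[ℝ] E3} {c₀ : E3}

variable (hA : Adm₀ A) (hI : Inner₀ t A)

set_option quotPrecheck false in
-- Local notation: the operator row `(L v)(p)`.
local notation "𝕃" v:max " @ " p:max =>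
  tsum (fun q : Sites₀ t A => (if ((p : Sites₀ t A) : E3) ≠ q then 𝕂[((p : Sites₀ t A) : E3) - q] (v ((p : Sites₀ t A) : E3) - v q) else 0))
set_option quotPrecheck false in
-- Local notation: the finite near-neighbour form on the ball of radius `X` about `c₀`.
local notation "NN[" v ", " X "]" =>
  (∑ p ∈ (finite_sites_dist_le (t := t) (A := A) hA hI c₀ X).toFinset,
    ∑ q ∈ (finite_sites_dist_le (t := t) (A := A) hA hI c₀ X).toFinset,
      (if p ≠ q ∧ dist p q ≤ 11 / 10 then ‖v p - v q‖ ^ 2 else (0 : ℝ)))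
set_option quotPrecheck false in
-- local mass on the ball of radius `X` about `c₀`
local notation "𝐌[" f ", " X "]" =>
  tsum (fun p : Sites₀ t A => ‖f (p : E3)‖ ^ 2 * 𝟙ᵇ[p, c₀, X])
set_option quotPrecheck false in
-- the level constant `L = (4Cₐ + 24Cⱼ)/κ + 1`
local notation "𝐋" => ((4 * Cₐ + 24 * Cⱼ) / κ + 1)
set_option quotPrecheck false in
-- Local notation: the displaced self-force `G(p)` of the background `aff`.
local notation "𝐆[" aff "] " p:max =>
  tsum (fun q : Sites₀ t A => (if (p : E3) ≠ q then 𝐅[((p : E3) - q) + (aff (p : E3) - aff q)] else 0))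

/-- `(α + β + γ)²`-type bound: if `‖y‖ ≤ α + β + γ` then `‖y‖² ≤ 3α² + 3β² + 3γ²`.
[folklore] -/
theorem norm_sq_le_three {y : E3} {α β γ : ℝ} (h : ‖y‖ ≤ α + β + γ) :
    ‖y‖ ^ 2 ≤ 3 * α ^ 2 + 3 * β ^ 2 + 3 * γ ^ 2 := by
  have h1 : ‖y‖ ^ 2 ≤ (α + β + γ) ^ 2 := pow_le_pow_left₀ (norm_nonneg _) h 2
  nlinarith [sq_nonneg (α - β), sq_nonneg (β - γ), sq_nonneg (α - γ)]

include hA hI in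
/-- **The Taylor error at one site of `B_ρ(c₀)`, base site included**: from the pointwise bound off the
base site and the Taylor clause at the base site (`L = 11/10`, `N = 7`). [folklore] -/
theorem taylor_error_at (h : E3 → E3) {z₀ : E3} (hz₀ : z₀ ∈ Λ₀) (hp₀c : dist (t 0 + A z₀) c₀ ≤ 11 / 10)
    (aT : Fin 2 → E3) (BT : E3 →L[ℝ] E3) {ρ Θ₂ : ℝ} (hΘ₂0 : 0 ≤ Θ₂)
    (hbase : ‖h (t 0 + A z₀) - (aT 0 + BT (t 0 + A z₀ - (t 0 + A z₀)))‖ ^ 2 ≤ 144 * (7 : ℝ) ^ 4 * Θ₂)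
    (hpt : ∀ x ∈ Sites₀ t A, x ≠ t 0 + A z₀ → dist x c₀ ≤ ρ →
      ‖h x - ((fun x : E3 => (if (∃ z ∈ Λ₀, x = t 1 + A z) then aT 1 else aT 0) + BT (x - (t 0 + A z₀))) x)‖ ≤
        1428 * Real.sqrt Θ₂ * (dist x (t 0 + A z₀)) ^ 2)
    {x : E3} (hx : x ∈ Sites₀ t A) (hxd : dist x c₀ ≤ ρ) :
    ‖h x - ((if (∃ z ∈ Λ₀, x = t 1 + A z) then aT 1 else aT 0) + BT (x - (t 0 + A z₀)))‖ ≤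
      1428 * Real.sqrt Θ₂ * (dist x c₀ + 11 / 10) ^ 2 := by
  have hs0 : 0 ≤ Real.sqrt Θ₂ := Real.sqrt_nonneg _
  by_cases hxp : x = t 0 + A z₀
  · have hif : (if (∃ z ∈ Λ₀, x = t 1 + A z) then aT 1 else aT 0) = aT 0 := by
      rw [if_neg]
      rintro ⟨z', hz', h'⟩
      exact sublattice_ne hA hI hz₀ hz' (hxp.symm.trans h')
    rw [hif, hxp]
    have h3 : (12 * 49 * Real.sqrt Θ₂) ^ 2 = 144 * (7 : ℝ) ^ 4 * Θ₂ := by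
      rw [mul_pow, Real.sq_sqrt hΘ₂0]; norm_num
    have h2 : ‖h (t 0 + A z₀) - (aT 0 + BT (t 0 + A z₀ - (t 0 + A z₀)))‖ ≤ 12 * 49 * Real.sqrt Θ₂ :=
      pow_le_pow_iff_left₀ (norm_nonneg _) (by positivity) (by norm_num : (2 : ℕ) ≠ 0) |>.1 (h3 ▸ hbase)
    refine h2.trans ?_
    have hd0 : 0 ≤ dist (t 0 + A z₀) c₀ := dist_nonneg
    have h4 : (121 / 100 : ℝ) ≤ (dist (t 0 + A z₀) c₀ + 11 / 10) ^ 2 := by nlinarith [hd0]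
    nlinarith [hs0, h4]
  · have h := hpt x hx hxp hxd
    simp only [] at h
    refine h.trans ?_
    have hdp : dist x (t 0 + A z₀) ≤ dist x c₀ + 11 / 10 := by
      have := dist_triangle x c₀ (t 0 + A z₀)
      rw [dist_comm c₀] at this
      linarith only [this, hp₀c]
    have hd0 : 0 ≤ dist x (t 0 + A z₀) := dist_nonneg
    gcongr

include hA hI in
/-- **The induction step** (see the module docstring), downstream of `step_correction` (which supplies the
correction `w`, its zero rows, `Σ'‖w‖² ≤ W` and `nnForm w ≤ E_w`) and of `NN_le_poly` (the gradient quintic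
`q₁, …, q₅`). [folklore] -/
theorem induction_step (hκ0 : 0 < κ) (hκ1 : κ ≤ 1)
    (hκ : ∀ v : E3 → E3, (Function.support v).Finite →
      Function.support v ⊆ Sites₀ t A → κ * nnForm t A v ≤ ∑' p : Sites₀ t A, ⟪𝕃 v @ p, v p⟫)
    (hr : 192 ≤ r)
    (SR : Finset E3) (hSR : ∀ x, x ∈ SR ↔ x ∈ Sites₀ t A ∧ dist x c ≤ r)
    (χ : E3 → ℝ) (hχone : ∀ q ∈ SR, dist q c ≤ r / 2 → χ q = 1)
    (haff : ∀ (m : Fin 2) (z : E3), z ∈ Λ₀ → aff (t m + A z) = a m + B (t m + A z - c₀))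
    (hrelax : ∀ s : Sites₀ t A, 𝐆[aff] s = 0)
    (ha' : ‖a 0 - a 1‖ ≤ κ / (2 * 10 ^ 10)) (hB' : ‖B‖ ≤ κ / (2 * 10 ^ 10))
    (v ut w : E3 → E3) (hvdef : v = fun x => χ x • ut x) (hudef : ut = fun x => (π x - x) - aff x)
    (hv : (Function.support v).Finite) (hw : (Function.support w).Finite) (hc₀ : dist c₀ c ≤ r / 8)
    {C ρ Dv Msh Ntot q₁ q₂ q₃ q₄ q₅ : ℝ} (hC : 0 ≤ C) (hρ : 64 ≤ ρ) (hρr : 737600 * ρ + 153600 ≤ r) (hN : 0 ≤ Ntot)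
    (hq₁ : 0 ≤ q₁) (hq₂ : 0 ≤ q₂) (hq₃ : 0 ≤ q₃) (hq₄ : 0 ≤ q₄) (hq₅ : 0 ≤ q₅)
    (henv : ∀ x ∈ Sites₀ t A, dist x c₀ ≤ r / 4 → ‖v x‖ ^ 2 ≤ C * (max (dist x c₀) ρ) ^ 3)
    (hvD : ∀ x, ‖v x‖ ≤ Dv)
    (hsupp : ∀ x ∈ Sites₀ t A, 7 * r / 8 < dist x c₀ → v x = 0) (hsupp' : ∀ x, v x ≠ 0 → x ∈ Sites₀ t A)
    (hMsh : 𝐌[v, 4 * (1280 * (9 * ρ) + 2388) + 4] ≤ Msh)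
    (hnear : ∀ a, ρ ≤ a → 32 * a ≤ r → NN[v, a] ≤ q₁ * a + q₂ * a ^ 2 + q₃ * a ^ 3 + q₄ * a ^ 4 + q₅ * a ^ 5)
    (hNNtot : ∀ X, NN[v, X] ≤ Ntot)
    -- the correction
    (hrows : ∀ p : Sites₀ t A, dist (p : E3) c₀ ≤ 2 * (1280 * (9 * ρ) + 2388) + 4 → 𝕃 (fun x => v x + w x) @ p = 0)
    {W Ew Θ₁ Θ₂ V J : ℝ} (hWle : ∑' q : Sites₀ t A, ‖w q‖ ^ 2 ≤ W) (hEwle : nnForm t A w ≤ Ew) (hEw0 : 0 ≤ Ew)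
    -- the numerical parameters dominating the currencies
    (Y PY Lc Cs Cb : ℝ) (hYdef : Y = 10 * (9 * ρ) + 10)
    (hPY : PY = 2 * (4 * q₁ * Y + 4 ^ 2 * q₂ * Y ^ 2 + 4 ^ 3 * q₃ * Y ^ 3 + 4 ^ 4 * q₄ * Y ^ 4 + 4 ^ 5 * q₅ * Y ^ 5) / Y ^ 8 +
      256 * Ntot / ((r / 64) ^ 7 * Y))
    (hLc : Lc = 𝐋) (hCs : Cs = Cˢ) (hCb : Cb = Cᴮ)
    (hΘ₁ : 64 * Lc ^ 3 / (9 * ρ) ^ 3 * (Lc * ((2 * Msh + 2 * W) / (1280 * (9 * ρ) + 2388) ^ 2 +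
        (2 * (4096 * C / Y ^ 2 + 8192 * (7 * r / 8) ^ 3 * Dv ^ 2 / ((r / 4) ^ 7 * Y)) + 2 * Y⁻¹ ^ 8 * W))) +
      536 * Lc ^ 3 * (9 * ρ) ^ 3 * (6 * (2 * PY + 2 * Y⁻¹ ^ 8 * Ew)) ≤ Θ₁)
    (hΘ₂ : 64 * Lc ^ 4 / (9 * ρ) ^ 5 * (Lc * ((2 * Msh + 2 * W) / (1280 * (9 * ρ) + 2388) ^ 2 +
        (2 * (4096 * C / Y ^ 2 + 8192 * (7 * r / 8) ^ 3 * Dv ^ 2 / ((r / 4) ^ 7 * Y)) + 2 * Y⁻¹ ^ 8 * W))) +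
      (64 * Lc ^ 4 / (9 * ρ) ^ 3 + 3216 * Lc ^ 4 * (9 * ρ) ^ 3) * (6 * (2 * PY + 2 * Y⁻¹ ^ 8 * Ew)) ≤ Θ₂)
    (hΘ₂0 : 0 ≤ Θ₂)
    (hV : Real.sqrt (C * ρ ^ 3) + Real.sqrt W ≤ V)
    (hJ : 2 * (4096 * C / ρ ^ 2 + 8192 * (7 * r / 8) ^ 3 * Dv ^ 2 / ((r / 4) ^ 7 * ρ)) + 2 * ρ⁻¹ ^ 8 * W ≤ J)
    -- the relaxation regime
    (hs₁ : 12 * Real.sqrt Θ₁ ≤ κ / (2 * 10 ^ 10))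
    (hs₂ : 2 / κ * (38 * (1024 / ((23 / 25 : ℝ) ^ 3 * (23 / 25 : ℝ) ^ 4)) * (12 * Real.sqrt Θ₁) +
      38 * (1024 / ((23 / 25 : ℝ) ^ 3 * (23 / 25 : ℝ) ^ 3)) * (1428 * Real.sqrt Θ₂) +
      38 * (1024 / ((23 / 25 : ℝ) ^ 3 * (ρ - 11 / 10) ^ 5)) * (V + 11 / 10 * (12 * Real.sqrt Θ₁)) +
      38 * (1024 / ((23 / 25 : ℝ) ^ 3 * (ρ - 11 / 10) ^ 4)) * (12 * Real.sqrt Θ₁) +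
      38 * Real.sqrt (1024 / ((23 / 25 : ℝ) ^ 3 * (ρ - 11 / 10) ^ 5)) * Real.sqrt (39 * J)) ≤ κ / (2 * 10 ^ 10))
    (hs₃ : Cs * (κ / (2 * 10 ^ 10)) + Cb * (12 * Real.sqrt Θ₁) ≤ κ ^ 2 / 10 ^ 11) :
    ∃ (z₀ : E3) (aT : Fin 2 → E3) (BT : E3 →L[ℝ] E3) (ξ : E3),
      z₀ ∈ Λ₀ ∧ dist (t 0 + A z₀) c₀ ≤ 11 / 10 ∧
      ‖BT‖ ≤ 12 * Real.sqrt Θ₁ ∧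
      ‖aT 0 - aT 1‖ ≤ κ / (2 * 10 ^ 10) ∧
      (∀ m, ‖aT m‖ ≤ V + 11 / 10 * ‖BT‖) ∧
      ‖ξ‖ ≤ 4 / κ * (Cs * ‖aT 0 - aT 1‖ + Cb * ‖BT‖) ∧
      (∀ (m : Fin 2) (z : E3), z ∈ Λ₀ →
        (fun x : E3 => aff x + ((if (∃ z ∈ Λ₀, x = t 1 + A z) then aT 1 else aT 0) + BT (x - (t 0 + A z₀))) +
          (if (∃ z ∈ Λ₀, x = t 0 + A z) then ξ else 0)) (t m + A z) =
          (![a 0 + aT 0 + BT (c₀ - (t 0 + A z₀)) + ξ, a 1 + aT 1 + BT (c₀ - (t 0 + A z₀))] : Fin 2 → E3) m +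
            (B + BT) (t m + A z - c₀)) ∧
      (∀ p : Sites₀ t A, 𝐆[fun x : E3 => aff x + ((if (∃ z ∈ Λ₀, x = t 1 + A z) then aT 1 else aT 0) + BT (x - (t 0 + A z₀))) +
          (if (∃ z ∈ Λ₀, x = t 0 + A z) then ξ else 0)] p = 0) ∧
      (∀ x ∈ Sites₀ t A, dist x c₀ ≤ ρ →
        ‖χ x • ((π x - x) - (aff x + ((if (∃ z ∈ Λ₀, x = t 1 + A z) then aT 1 else aT 0) + BT (x - (t 0 + A z₀))) +
          (if (∃ z ∈ Λ₀, x = t 0 + A z) then ξ else 0)))‖ ^ 2 ≤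
          3 * (1428 * Real.sqrt Θ₂ * (dist x c₀ + 11 / 10) ^ 2) ^ 2 + 3 * W + 3 * ‖ξ‖ ^ 2) := by
  subst hYdef hPY hLc hCs hCb
  have hρ1 : (1 : ℝ) ≤ ρ := by linarith only [hρ]
  have hr8 : 8 * ρ ≤ r := by linarith only [hρr, hρ]
  have hYρ : ρ ≤ 10 * (9 * ρ) + 10 := by linarith only [hρ]
  -- (1) the inputs of the linear step
  obtain ⟨hMh, hJhY, hJΔ, hVh⟩ := step_h_currencies hA hI v w hv hw hr hC hρ hr8 hq₁ hq₂ hq₃ hq₄ hq₅ hN hEw0 henv hvD hsupp hsupp'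
    hMsh hnear hNNtot hWle hEwle (Y := 10 * (9 * ρ) + 10) hYρ
  obtain ⟨-, hJhρ, -, -⟩ := step_h_currencies hA hI v w hv hw hr hC hρ hr8 hq₁ hq₂ hq₃ hq₄ hq₅ hN hEw0 henv hvD hsupp hsupp'
    hMsh hnear hNNtot hWle hEwle (Y := ρ) le_rfl
  have hh : (Function.support (fun x => v x + w x)).Finite := by
    refine (hv.union hw).subset fun x hx => ?_
    simp only [Function.mem_support, ne_eq, Set.mem_union] at hx ⊢
    by_contra h0
    push Not at h0
    exact hx (by rw [h0.1, h0.2, add_zero])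
  have hVf : ∀ x ∈ Sites₀ t A, dist x c₀ ≤ 11 / 5 → ‖(fun x => v x + w x) x‖ ≤ V := fun x hx hd => (hVh x hx hd).trans hV
  have hJf : tsum (fun q : Sites₀ t A => ‖(fun x => v x + w x) (q : E3)‖ ^ 2 * (max (dist (q : E3) c₀) ρ)⁻¹ ^ 8) ≤ J :=
    hJhρ.trans hJ
  have hL0 : 0 ≤ 𝐋 := by positivity
  have hR10 : (0 : ℝ) < (1280 * (9 * ρ) + 2388) := by linarith only [hρ]
  have hΘ₁' : 64 * 𝐋 ^ 3 / (9 * ρ) ^ 3 * (𝐋 * (𝐌[(fun x => v x + w x), 4 * (1280 * (9 * ρ) + 2388) + 4] / (1280 * (9 * ρ) + 2388) ^ 2 +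
        tsum (fun q : Sites₀ t A => ‖(fun x => v x + w x) (q : E3)‖ ^ 2 * (max (dist (q : E3) c₀) (10 * (9 * ρ) + 10))⁻¹ ^ 8))) +
      536 * 𝐋 ^ 3 * (9 * ρ) ^ 3 *
        (tsum (fun q : Sites₀ t A => ‖(fun x => (fun y => v y + w y) (x + A (triangularVec₁ 1)) - (fun y => v y + w y) x) (q : E3)‖ ^ 2 *
            (max (dist (q : E3) c₀) (10 * (9 * ρ) + 10))⁻¹ ^ 8) +
          tsum (fun q : Sites₀ t A => ‖(fun x => (fun y => v y + w y) (x + A (triangularVec₂ 1)) - (fun y => v y + w y) x) (q : E3)‖ ^ 2 *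
            (max (dist (q : E3) c₀) (10 * (9 * ρ) + 10))⁻¹ ^ 8) +
          tsum (fun q : Sites₀ t A => ‖(fun x => (fun y => v y + w y) (x + A (layerNormal (2 * Real.sqrt (2 / 3)))) - (fun y => v y + w y) x) (q : E3)‖ ^ 2 *
            (max (dist (q : E3) c₀) (10 * (9 * ρ) + 10))⁻¹ ^ 8)) ≤ Θ₁ := by
    refine le_trans ?_ hΘ₁
    have hρ9 : (0 : ℝ) ≤ 9 * ρ := by linarith only [hρ]
    gcongr
  have hΘ₂' : 64 * 𝐋 ^ 4 / (9 * ρ) ^ 5 * (𝐋 * (𝐌[(fun x => v x + w x), 4 * (1280 * (9 * ρ) + 2388) + 4] / (1280 * (9 * ρ) + 2388) ^ 2 +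
        tsum (fun q : Sites₀ t A => ‖(fun x => v x + w x) (q : E3)‖ ^ 2 * (max (dist (q : E3) c₀) (10 * (9 * ρ) + 10))⁻¹ ^ 8))) +
      (64 * 𝐋 ^ 4 / (9 * ρ) ^ 3 + 3216 * 𝐋 ^ 4 * (9 * ρ) ^ 3) *
        (tsum (fun q : Sites₀ t A => ‖(fun x => (fun y => v y + w y) (x + A (triangularVec₁ 1)) - (fun y => v y + w y) x) (q : E3)‖ ^ 2 *
            (max (dist (q : E3) c₀) (10 * (9 * ρ) + 10))⁻¹ ^ 8) +
          tsum (fun q : Sites₀ t A => ‖(fun x => (fun y => v y + w y) (x + A (triangularVec₂ 1)) - (fun y => v y + w y) x) (q : E3)‖ ^ 2 *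
            (max (dist (q : E3) c₀) (10 * (9 * ρ) + 10))⁻¹ ^ 8) +
          tsum (fun q : Sites₀ t A => ‖(fun x => (fun y => v y + w y) (x + A (layerNormal (2 * Real.sqrt (2 / 3)))) - (fun y => v y + w y) x) (q : E3)‖ ^ 2 *
            (max (dist (q : E3) c₀) (10 * (9 * ρ) + 10))⁻¹ ^ 8)) ≤ Θ₂ := by
    refine le_trans ?_ hΘ₂
    have hρ9 : (0 : ℝ) ≤ 9 * ρ := by linarith only [hρ]
    gcongr
  -- (2) the decay step
  obtain ⟨z₀, aT, BT, ξ, hz₀, hp₀c, hBT, hjump, hval, hξ, htay, hpt, haff', hrel'⟩ :=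
    step_decay hA hI hκ0 hκ1 hκ hh hρ hrows hVf hJf haff hrelax hB' ha' hΘ₁' hΘ₂' hs₁ hs₂ hs₃ hΘ₂0 (c₀ := c₀)
  -- the jump below the threshold
  have hBn : 0 ≤ ‖BT‖ := norm_nonneg _
  have hρ' : 0 < ρ - 11 / 10 := by linarith only [hρ]
  have hjump' : ‖aT 0 - aT 1‖ ≤ κ / (2 * 10 ^ 10) := by
    refine hjump.trans (le_trans ?_ hs₂)
    gcongr
  refine ⟨z₀, aT, BT, ξ, hz₀, hp₀c, hBT, hjump', hval, hξ, haff', hrel', fun x hx hxd => ?_⟩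
  -- (3) the quartic envelope on B_ρ(c₀)
  have hp₀ : t 0 + A z₀ ∈ Sites₀ t A := add_mem_sites₀ t0_mem_sites hz₀
  have hxc : dist x c ≤ r / 2 := by
    have := dist_triangle x c₀ c
    linarith only [this, hxd, hc₀, hρr, hρ]
  have hxSR : x ∈ SR := (hSR x).2 ⟨hx, by linarith only [hxc, hr]⟩
  have hχx : χ x = 1 := hχone x hxSR hxc
  have hux : (π x - x) - aff x = v x := by
    have h1 : v x = χ x • ut x := by rw [hvdef]
    rw [h1, hχx, one_smul, hudef]
  -- the Taylor error at x (including the base site)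
  have hbase : ‖(fun x => v x + w x) (t 0 + A z₀) - (aT 0 + BT (t 0 + A z₀ - (t 0 + A z₀)))‖ ^ 2 ≤ 144 * (7 : ℝ) ^ 4 * Θ₂ := by
    have h7 := htay (11 / 10) 7 (by norm_num) (by norm_num; linarith only [hρ]) 0 z₀ hz₀ hp₀c
    norm_num at h7 ⊢
    exact h7
  have herr := taylor_error_at hA hI (fun x => v x + w x) hz₀ hp₀c aT BT hΘ₂0 hbase hpt hx hxd
  -- the correction and the shift at x
  have hsumw : Summable (fun q : Sites₀ t A => ‖w q‖ ^ 2) := by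
    have := summable_normSq_mul_of_finite (t := t) (A := A) hw (fun _ => (1 : ℝ))
    simpa using this
  have hwx : ‖w x‖ ^ 2 ≤ W := (hsumw.le_tsum ⟨x, hx⟩ (fun q _ => by positivity)).trans hWle
  have hσx : ‖(if (∃ z ∈ Λ₀, x = t 0 + A z) then ξ else (0 : E3))‖ ≤ ‖ξ‖ := by
    split_ifs
    · exact le_rfl
    · rw [norm_zero]; exact norm_nonneg _
  -- assemble
  have hkey : (π x - x) - (aff x + ((if (∃ z ∈ Λ₀, x = t 1 + A z) then aT 1 else aT 0) + BT (x - (t 0 + A z₀))) +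
      (if (∃ z ∈ Λ₀, x = t 0 + A z) then ξ else 0)) =
      ((fun x => v x + w x) x - ((if (∃ z ∈ Λ₀, x = t 1 + A z) then aT 1 else aT 0) + BT (x - (t 0 + A z₀)))) - w x -
        (if (∃ z ∈ Λ₀, x = t 0 + A z) then ξ else 0) := by
    have e : (π x - x) - (aff x + ((if (∃ z ∈ Λ₀, x = t 1 + A z) then aT 1 else aT 0) + BT (x - (t 0 + A z₀))) +
        (if (∃ z ∈ Λ₀, x = t 0 + A z) then ξ else 0)) =
        ((π x - x) - aff x) - ((if (∃ z ∈ Λ₀, x = t 1 + A z) then aT 1 else aT 0) + BT (x - (t 0 + A z₀))) -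
          (if (∃ z ∈ Λ₀, x = t 0 + A z) then ξ else 0) := by abel
    rw [e, hux]
    simp only []
    abel
  rw [hkey, norm_smul, Real.norm_eq_abs, hχx, abs_one, one_mul]
  have hn : ‖((fun x => v x + w x) x - ((if (∃ z ∈ Λ₀, x = t 1 + A z) then aT 1 else aT 0) + BT (x - (t 0 + A z₀)))) - w x -
        (if (∃ z ∈ Λ₀, x = t 0 + A z) then ξ else 0)‖ ≤
      1428 * Real.sqrt Θ₂ * (dist x c₀ + 11 / 10) ^ 2 + Real.sqrt W + ‖ξ‖ := by
    refine (norm_sub_le _ _).trans (add_le_add ((norm_sub_le _ _).trans (add_le_add herr (Real.le_sqrt_of_sq_le hwx))) hσx)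
  have hW0 : 0 ≤ W := le_trans (tsum_nonneg fun q => by positivity) hWle
  have h := norm_sq_le_three hn
  rw [Real.sq_sqrt hW0] at h
  exact h

end

end Summit.AtomisticToContinuum.Crystallization.Theorems.ExcessDecayLiouville

end
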